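import Summits.NavierStokesRegularity.FunctionalMining.RateBudgets
import Summits.NavierStokesRegularity.FunctionalMining.Candidates
import Summits.NavierStokesRegularity.FunctionalMining.StrainMomentBalance
import Summits.NavierStokesRegularity.FunctionalMining.PressureMomentRate
import Literature.Analysis.FluidPDE.TorusVorticityTensorTransport
import HarnessLib

/-!
# FunctionalMining — the C3a / C3b rate shapes and their DOOR to static data (planar shadow, part 1)

Search for candidate a priori estimates; no regularity claim. Cell `pub-nsfunc`, prove seat
(gen 18). Nothing about regularity: typed K0 row shapes and an elementary reduction.

THE TWO COLUMNS. K0 (`dict/K0.json` v1.6, K0-FLAGS A7 / A11) tests each candidate functional `Φ` in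
the conditional shape `T_C`: `dΦ/dt ≤ C · m(u) · Φ` along classical solutions on `T³`, with the
multiplier `m = ‖λ₂⁺(S)‖_∞` (column **C3b**, SIEVE K) or `m = ‖α⁺‖_∞`, `α = ξᵀSξ = σ/|ω|²` (column
**C3a**, SIEVE Z0). The tree types the C3b column for the vorticity moments only
(`MiddleEigenvalueMomentRateBound q C`, `Candidates.lean`). Here, for an ARBITRARY functional `Φ`:

* `FunctionalMidEigRateBound Φ C` — column C3b in majorant form (every `Λ ≥ 0` dominating the middle
  strain eigenvalue pointwise; literally `MiddleEigenvalueMomentRateBound q C` at `Φ = Z_q`,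
  `middleEigenvalueMomentRateBound_iff_functional`);
* `FunctionalStretchRateBound Φ C` — column C3a in majorant form (every `A ≥ 0` with
  `σ ≤ A|ω|²` pointwise, i.e. `A` dominates `α⁺` wherever `ω ≠ 0`);
* `FunctionalStretchLogBudget Φ e j C c` — the `T_CL|C3a|j` variant (extra factor
  `log^j(e + cΦ/ν^e)`, as in `StrainMomentLogBudget`; only used at `A = 0` below, where the factor is
  immaterial).

THE DOOR (dynamic ⇒ static). If `Φ` has initial rates `(N, V)` along classical solutions
(`HasInitialRate Φ N V`, `RateBudgets.lean`) then each row forces, at every smooth divergence-free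
zero-mean datum `u₀` whose multiplier VANISHES — `λ₂(S(u₀)) ≤ 0` pointwise (C3b), resp.
`σ(u₀) ≤ 0` pointwise (C3a) — the sign `N(u₀) ≤ 0`: solve Navier–Stokes from `u₀` for `ν > 0`
(`Torus.exists_classicalNS_smooth`), read the row at the initial time with `Λ = 0` (resp. `A = 0`),
get `N(u₀) + νV(u₀) ≤ 0`, and let `ν → 0⁺` (`inertialRate_nonpos_of_forall`). This is SIEVEK's
Lemma 0 / Lemma 1″ mechanism ("evaluation transfer at a multiplier-free field") in the kernel.

Also: the initial rates of the strain moments `∫|S|^q`, real `q ≥ 2`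
(`hasInitialRate_torusStrainMoment`: `N_q = −q∫(|S|²)^{q/2−1} S:(∇²π + ∇u∇u)`,
`V_q = q∫(|S|²)^{q/2−1} S:∇Δu`, from `GradientTensor.hasDerivWithinAt_integral_strainSqAt_rpow_unforced`
and `pressureOf_eq_pressure_sub_integral`), so that the rows `ES.absS.q|T_C|C3a/C3b` enter the door.
Part 2 (`PlanarShadowWitness`, `PlanarShadowRates`, `PlanarShadowKill`) supplies a planar datum with
`λ₂ ≡ 0`, `σ ≡ 0` and positive inertial rates, closing nine K0 rows for every `C`.
-/

noncomputable section

open MeasureTheory Set Filter Topology Finset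
open scoped InnerProductSpace RealInnerProductSpace

namespace Summit.NavierStokesRegularity.FunctionalMining

open Literature.Analysis Literature.Analysis.FunctionSpaces Literature.Analysis.FunctionSpaces.Torus
  Literature.Analysis.FluidPDE

variable {d : Type*} [Fintype d] [DecidableEq d]

/-! ## 1. The shapes -/

/-- **Column C3b for a functional `Φ` (shape `T_C`, multiplier `‖λ₂⁺(S)‖_∞`, majorant form).**
Along every classical solution of unforced Navier–Stokes/Euler (`ν ≥ 0`) on `T³ × [a, b]`, at every
time `t` where the middle eigenvalue of the strain `S = ½((∂ⱼu)ᵢ + (∂ᵢu)ⱼ)` is `≤ Λ` everywhere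
(`Λ ≥ 0`; Mathlib's decreasing `eigenvalues₀`, index `1` of `3`), every one-sided derivative value `R`
of `s ↦ Φ(u s)` within `[a, b]` at `t` satisfies `R ≤ C Λ Φ(u t)`. Search for candidate a priori
estimates; no regularity claim — nothing is asserted. [ours; typed K0 shape] -/
def FunctionalMidEigRateBound (Φ : (UnitAddTorus d → EuclideanSpace ℝ d) → ℝ) (C : ℝ) : Prop :=
  ∀ hd : Fintype.card d = 3, ∀ {ν : ℝ}, 0 ≤ ν → ∀ {a b : ℝ}, a < b →
    ∀ {u : ℝ → UnitAddTorus d → EuclideanSpace ℝ d} {p : ℝ → UnitAddTorus d → ℝ},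
      Torus.IsClassicalNSSolutionOn (Icc a b) ν 0 u p →
      ∀ t ∈ Icc a b, ∀ Λ : ℝ, 0 ≤ Λ →
        (∀ x, ∀ hx : (Matrix.of fun i j =>
            (Torus.partialDeriv j (u t) x i + Torus.partialDeriv i (u t) x j) / 2).IsHermitian,
            hx.eigenvalues₀ (Fin.cast hd.symm 1) ≤ Λ) →
        ∀ R : ℝ, HasDerivWithinAt (fun s => Φ (u s)) R (Icc a b) t → R ≤ C * Λ * Φ (u t)

/-- The tree's K1-Q2 row is literally the C3b shape of `Z_q`. [ours; bookkeeping] -/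
theorem middleEigenvalueMomentRateBound_iff_functional (q C : ℝ) :
    MiddleEigenvalueMomentRateBound (d := d) q C ↔
      FunctionalMidEigRateBound (d := d) (torusVorticityMoment q) C :=
  Iff.rfl

/-- **Column C3a for a functional `Φ` (shape `T_C`, multiplier `‖α⁺‖_∞`, `α = σ/|ω|²`, majorant
form).** As above, with the hypothesis "`σ(u t, x) ≤ A·|ω(u t, x)|²` for all `x`" (`A ≥ 0`; `σ` the
vortex-stretching density `torusStretchingDensity`, `|ω|²` = `torusVorticitySqAt`): every `A`
dominating `α⁺` on `{ω ≠ 0}` is admissible, and the conclusion is `R ≤ C A Φ(u t)`. Search for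
candidate a priori estimates; no regularity claim — nothing is asserted. [ours; typed K0 shape] -/
def FunctionalStretchRateBound (Φ : (UnitAddTorus d → EuclideanSpace ℝ d) → ℝ) (C : ℝ) : Prop :=
  Fintype.card d = 3 → ∀ {ν : ℝ}, 0 ≤ ν → ∀ {a b : ℝ}, a < b →
    ∀ {u : ℝ → UnitAddTorus d → EuclideanSpace ℝ d} {p : ℝ → UnitAddTorus d → ℝ},
      Torus.IsClassicalNSSolutionOn (Icc a b) ν 0 u p →
      ∀ t ∈ Icc a b, ∀ A : ℝ, 0 ≤ A →
        (∀ x, torusStretchingDensity (u t) x ≤ A * torusVorticitySqAt (u t) x) →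
        ∀ R : ℝ, HasDerivWithinAt (fun s => Φ (u s)) R (Icc a b) t → R ≤ C * A * Φ (u t)

/-- **Column C3a, logarithmic shape `T_CL|C3a|j`** (`ν > 0`; slowly varying factor
`log^j(e + c·Φ/ν^e)` with the unit-torus nondimensionalisation exponent `e` of the functional, as in
`StrainMomentLogBudget` where `e = q`). Search for candidate a priori estimates; no regularity claim —
nothing is asserted. [ours; typed K0 shape] -/
def FunctionalStretchLogBudget (Φ : (UnitAddTorus d → EuclideanSpace ℝ d) → ℝ) (e : ℝ) (j : ℕ)
    (C c : ℝ) : Prop :=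
  Fintype.card d = 3 → ∀ {ν : ℝ}, 0 < ν → ∀ {a b : ℝ}, a < b →
    ∀ {u : ℝ → UnitAddTorus d → EuclideanSpace ℝ d} {p : ℝ → UnitAddTorus d → ℝ},
      Torus.IsClassicalNSSolutionOn (Icc a b) ν 0 u p →
      ∀ t ∈ Icc a b, ∀ A : ℝ, 0 ≤ A →
        (∀ x, torusStretchingDensity (u t) x ≤ A * torusVorticitySqAt (u t) x) →
        ∀ R : ℝ, HasDerivWithinAt (fun s => Φ (u s)) R (Icc a b) t →
          R ≤ C * A * Φ (u t) * Real.log (Real.exp 1 + c * Φ (u t) / ν ^ e) ^ j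

/-! ## 2. The door: a row plus initial rates forces `N ≤ 0` at multiplier-free data -/

omit [Fintype d] [DecidableEq d] in
/-- `N + νV ≤ 0` for all `ν > 0` forces `N ≤ 0`. [folklore] -/
theorem inertialRate_nonpos_of_forall {N V : ℝ} (h : ∀ ν : ℝ, 0 < ν → N + ν * V ≤ 0) : N ≤ 0 := by
  by_contra hN
  have hN' : 0 < N := not_le.mp hN
  set ν : ℝ := N / (2 * (|V| + 1)) with hνdef
  have hνpos : 0 < ν := by positivity
  have h1 := h ν hνpos
  have h2 : -(ν * |V|) ≤ ν * V := by
    rw [← mul_neg]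
    exact mul_le_mul_of_nonneg_left (neg_abs_le _) hνpos.le
  have h3 : ν * |V| < N := by
    rw [hνdef, div_mul_eq_mul_div, div_lt_iff₀ (by positivity)]
    nlinarith [abs_nonneg V]
  linarith

/-- **C3b door.** A C3b row for `Φ` and initial rates `(N, V)` give `N(u₀) ≤ 0` at every smooth
divergence-free zero-mean datum on `T³` whose middle strain eigenvalue is `≤ 0` everywhere (the
multiplier vanishes: `Λ = 0` is admissible at the initial time). [ours] -/
theorem FunctionalMidEigRateBound.inertialRate_nonpos
    {Φ N V : (UnitAddTorus d → EuclideanSpace ℝ d) → ℝ} {C : ℝ}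
    (hB : FunctionalMidEigRateBound Φ C) (hNV : HasInitialRate Φ N V) (hd : Fintype.card d = 3)
    {u₀ : UnitAddTorus d → EuclideanSpace ℝ d} (hu₀ : Torus.IsSmooth u₀) (hdiv : Torus.IsDivFree u₀)
    (hmean : Torus.HasZeroMean u₀)
    (hΛ : ∀ x, ∀ hx : (Matrix.of fun i j =>
        (Torus.partialDeriv j u₀ x i + Torus.partialDeriv i u₀ x j) / 2).IsHermitian,
        hx.eigenvalues₀ (Fin.cast hd.symm 1) ≤ 0) :
    N u₀ ≤ 0 := by
  refine inertialRate_nonpos_of_forall (V := V u₀) fun ν hν => ?_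
  obtain ⟨T, hT, v, p, hsol, hv0, -⟩ :=
    Torus.exists_classicalNS_smooth (d := d) hd.le hν.le hu₀ hdiv
  have hmean' : ∀ t ∈ Icc 0 T, Torus.HasZeroMean (v t) := fun t ht =>
    hsol.hasZeroMean_of_hasZeroMean (convex_Icc 0 T) (left_mem_Icc.2 hT.le) ht (hv0 ▸ hmean)
  have h0 : (0 : ℝ) ∈ Icc 0 T := left_mem_Icc.2 hT.le
  have hder : HasDerivWithinAt (fun s => Φ (v s)) (N (v 0) + ν * V (v 0)) (Icc 0 T) 0 :=
    hNV hd hν hT hsol hmean'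
  have hΛ' : ∀ x, ∀ hx : (Matrix.of fun i j =>
      (Torus.partialDeriv j (v 0) x i + Torus.partialDeriv i (v 0) x j) / 2).IsHermitian,
      hx.eigenvalues₀ (Fin.cast hd.symm 1) ≤ 0 := by
    rw [hv0]; exact hΛ
  have hle := hB hd hν.le hT hsol 0 h0 0 le_rfl hΛ' _ hder
  rw [hv0] at hle
  simpa using hle

/-- **C3a door.** A C3a row for `Φ` and initial rates `(N, V)` give `N(u₀) ≤ 0` at every smooth
divergence-free zero-mean datum on `T³` with `σ(u₀) ≤ 0` everywhere (`A = 0` admissible). [ours] -/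
theorem FunctionalStretchRateBound.inertialRate_nonpos
    {Φ N V : (UnitAddTorus d → EuclideanSpace ℝ d) → ℝ} {C : ℝ}
    (hB : FunctionalStretchRateBound Φ C) (hNV : HasInitialRate Φ N V) (hd : Fintype.card d = 3)
    {u₀ : UnitAddTorus d → EuclideanSpace ℝ d} (hu₀ : Torus.IsSmooth u₀) (hdiv : Torus.IsDivFree u₀)
    (hmean : Torus.HasZeroMean u₀) (hσ : ∀ x, torusStretchingDensity u₀ x ≤ 0) :
    N u₀ ≤ 0 := by
  refine inertialRate_nonpos_of_forall (V := V u₀) fun ν hν => ?_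
  obtain ⟨T, hT, v, p, hsol, hv0, -⟩ :=
    Torus.exists_classicalNS_smooth (d := d) hd.le hν.le hu₀ hdiv
  have hmean' : ∀ t ∈ Icc 0 T, Torus.HasZeroMean (v t) := fun t ht =>
    hsol.hasZeroMean_of_hasZeroMean (convex_Icc 0 T) (left_mem_Icc.2 hT.le) ht (hv0 ▸ hmean)
  have h0 : (0 : ℝ) ∈ Icc 0 T := left_mem_Icc.2 hT.le
  have hder : HasDerivWithinAt (fun s => Φ (v s)) (N (v 0) + ν * V (v 0)) (Icc 0 T) 0 :=
    hNV hd hν hT hsol hmean'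
  have hσ' : ∀ x, torusStretchingDensity (v 0) x ≤ 0 * torusVorticitySqAt (v 0) x := by
    intro x; rw [hv0, zero_mul]; exact hσ x
  have hle := hB hd hν.le hT hsol 0 h0 0 le_rfl hσ' _ hder
  rw [hv0] at hle
  simpa using hle

/-- **C3a logarithmic door.** The same for the `T_CL|C3a|j` shape (the log factor is killed by
`A = 0`). [ours] -/
theorem FunctionalStretchLogBudget.inertialRate_nonpos
    {Φ N V : (UnitAddTorus d → EuclideanSpace ℝ d) → ℝ} {e : ℝ} {j : ℕ} {C c : ℝ}
    (hB : FunctionalStretchLogBudget Φ e j C c) (hNV : HasInitialRate Φ N V) (hd : Fintype.card d = 3)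
    {u₀ : UnitAddTorus d → EuclideanSpace ℝ d} (hu₀ : Torus.IsSmooth u₀) (hdiv : Torus.IsDivFree u₀)
    (hmean : Torus.HasZeroMean u₀) (hσ : ∀ x, torusStretchingDensity u₀ x ≤ 0) :
    N u₀ ≤ 0 := by
  refine inertialRate_nonpos_of_forall (V := V u₀) fun ν hν => ?_
  obtain ⟨T, hT, v, p, hsol, hv0, -⟩ :=
    Torus.exists_classicalNS_smooth (d := d) hd.le hν.le hu₀ hdiv
  have hmean' : ∀ t ∈ Icc 0 T, Torus.HasZeroMean (v t) := fun t ht =>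
    hsol.hasZeroMean_of_hasZeroMean (convex_Icc 0 T) (left_mem_Icc.2 hT.le) ht (hv0 ▸ hmean)
  have h0 : (0 : ℝ) ∈ Icc 0 T := left_mem_Icc.2 hT.le
  have hder : HasDerivWithinAt (fun s => Φ (v s)) (N (v 0) + ν * V (v 0)) (Icc 0 T) 0 :=
    hNV hd hν hT hsol hmean'
  have hσ' : ∀ x, torusStretchingDensity (v 0) x ≤ 0 * torusVorticitySqAt (v 0) x := by
    intro x; rw [hv0, zero_mul]; exact hσ x
  have hle := hB hd hν hT hsol 0 h0 0 le_rfl hσ' _ hder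
  rw [hv0] at hle
  simpa using hle

/-! ## 3. The initial rates of the strain moments `∫|S|^q`, real `q ≥ 2` -/

/-- **Inertial rate of `∫|S|^q`**: `N_q(v) = −q∫(|S|²)^{q/2−1} ∑ᵢⱼ Sᵢⱼ (∂ᵢ∂ⱼπ_v + ∑ₖ∂ᵢvₖ∂ₖvⱼ)`
(`π_v = pressureOf v` the zero-mean pressure). [ours; bookkeeping] -/
def strainMomentInertialRate (q : ℝ) (v : UnitAddTorus d → EuclideanSpace ℝ d) : ℝ :=
  -(q * (∫ x, torusStrainSqAt v x ^ (q / 2 - 1) * ∑ i, ∑ j,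
      (Torus.partialDeriv j v x i + Torus.partialDeriv i v x j) / 2 *
        Torus.partialDeriv i (Torus.partialDeriv j (pressureOf v)) x)) -
    q * ∫ x, torusStrainSqAt v x ^ (q / 2 - 1) * ∑ i, ∑ j,
      (Torus.partialDeriv j v x i + Torus.partialDeriv i v x j) / 2 *
        ∑ k, Torus.partialDeriv i v x k * Torus.partialDeriv k v x j

/-- **Viscous rate of `∫|S|^q`**: `V_q(v) = q∫(|S|²)^{q/2−1} ∑ᵢⱼ Sᵢⱼ ∂ᵢ(Δv)ⱼ`. [ours; bookkeeping] -/
def strainMomentViscousRate (q : ℝ) (v : UnitAddTorus d → EuclideanSpace ℝ d) : ℝ :=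
  q * ∫ x, torusStrainSqAt v x ^ (q / 2 - 1) * ∑ i, ∑ j,
    (Torus.partialDeriv j v x i + Torus.partialDeriv i v x j) / 2 *
      Torus.partialDeriv i (Torus.laplacian v) x j

/-- **The initial rates of the rows `ES.absS.q`, real `q ≥ 2`**:
`HasInitialRate (torusStrainMoment q) N_q V_q` on `T³` (the exact balance
`hasDerivWithinAt_integral_strainSqAt_rpow_unforced` at the initial time, with the solution's pressure
Hessian rewritten as the Hessian of `π_{u(a)} = p(a) − ∫p(a)`). [ours] -/
theorem hasInitialRate_torusStrainMoment [Nonempty d] {q : ℝ} (hq : 2 ≤ q) :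
    HasInitialRate (d := d) (torusStrainMoment q) (strainMomentInertialRate q)
      (strainMomentViscousRate q) := by
  intro hd ν hν a b hab u p hsol _hmean
  have ha : a ∈ Icc a b := left_mem_Icc.2 hab.le
  have hD := GradientTensor.hasDerivWithinAt_integral_strainSqAt_rpow_unforced hsol hab hq ha
  have hπ : ∀ i j x, Torus.partialDeriv i (Torus.partialDeriv j (pressureOf (u a))) x =
      Torus.partialDeriv i (Torus.partialDeriv j (p a)) x := by
    intro i j x
    rw [pressureOf_eq_pressure_sub_integral hsol hab ha]
    have h1 : Torus.partialDeriv j (fun y => p a y - ∫ y, p a y) = Torus.partialDeriv j (p a) :=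
      funext fun y => partialDeriv_fun_sub_const (p a) _ j y
    rw [h1]
  unfold torusStrainMoment
  refine hD.congr_deriv ?_
  simp only [strainMomentInertialRate, strainMomentViscousRate, hπ]
  ring

end Summit.NavierStokesRegularity.FunctionalMining

end
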